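import Mathlib.Analysis.Complex.BorelCaratheodory
import Summits.HubbardSuperconductivity.HubbardSuperconductivity.Theorems.NodalWardXYPerturbedXYOrderReduction

/-!
# `PerturbedXYOrder` (stmt-HubbardSuperconductivity-10739) — the crux is EQUIVALENT to complex stability

Crux (route `NodalWardXY`, rank 3): `Summit.HubbardSuperconductivity.HubbardSuperconductivity.Theses.NodalWardXY.PerturbedXYOrder`.

The line `schwarz-inheritance` reduced the crux to its single open stub, *complex stability*
(`∃ J₀ ε₂ B, 0 < ε₂ ∧ 0 < B ∧ ∀ J ≥ J₀, ∀ L ≥ 2, ∀ K ∈ Adm(ε₂), Z_K ≠ 0 ∧ ‖num_K/Z_K/L⁶‖ ≤ B`), by the landed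
`perturbedXYOrder_of_complexStability` (`Theorems/NodalWardXYPerturbedXYOrderReduction.lean`). This file proves the CONVERSE,
`complexStability_of_perturbedXYOrder`, and records the equivalence `perturbedXYOrder_iff_complexStability`: the open stub is not a
strengthening of the crux but the crux itself with the real `K = 0` order and the Schwarz step stripped off. Consequently promoting the
stub to its own engine item loses nothing and adds nothing.

Proof of the converse (classical; drefute note `Cruxes/PerturbedXYOrder/DrefuteSchwarzInheritance.md` §3, second half): given the crux
with `(J₀, ε, a)`, take radius `ε/2`. For `K ∈ Adm(ε/2)` the ray `t ↦ t • K` stays in `Adm(ε)` for `‖t‖ ≤ 2`, so on the disc `‖t‖ < 2`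
the function `f(t) = cratio L J (t • K)` is holomorphic (`stub_entire`, `Z(tK) ≠ 0`) with `Re f ≥ a > 0`. The Borel–Carathéodory
theorem (`Complex.borelCaratheodory`, applied to `-f` with `M = 1`, `R = 2`, at `t = 1`) gives `‖f(1)‖ ≤ 2 + 3‖f(0)‖ ≤ 5`
(`‖cratio L J 0‖ ≤ 1`, `norm_cratio_zero_le_one`). Hence complex stability holds with `(J₀, ε/2, B = 5)`.
-/

noncomputable section

-- `<Problem> = <Summit>` doubles the path component (project-wide `weak.linter.dupNamespace = false` in the lakefile;
-- repeated here so that single-file elaboration is warning-free too).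
set_option linter.dupNamespace false

namespace Summit.HubbardSuperconductivity.HubbardSuperconductivity.Theorems.PerturbedXYOrder

open MeasureTheory Metric Literature.Probability.LatticeModels
open Summit.HubbardSuperconductivity.HubbardSuperconductivity.Theses.NodalWardXY

variable {L : ℕ}

/-- Along the ray through a kernel admissible at radius `ε/2`, every `t • K` with `‖t‖ ≤ 2` is admissible at radius `ε`. -/
theorem equiv_admissible_ray [NeZero L] {ε : ℝ} (hε : 0 ≤ ε) {K : Bond L → Bond L → ℂ}
    (hK : Admissible L (ε / 2) K) {t : ℂ} (ht : ‖t‖ ≤ 2) : Admissible L ε (t • K) :=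
  sch_admissible_smul (by nlinarith [norm_nonneg t]) hK

/-- The complex plateau along a ray, `t ↦ cratio L J (t • K)`, is holomorphic wherever `Z(tK) ≠ 0`. -/
theorem equiv_differentiableAt_cratio_ray [NeZero L] (J : ℝ) (K : Bond L → Bond L → ℂ) {t : ℂ}
    (hZ : Zk J (t • K) ≠ 0) : DifferentiableAt ℂ (fun s : ℂ => cratio L J (s • K)) t := by
  obtain ⟨hZd, hNd⟩ := stub_entire J L K
  unfold cratio
  exact ((hNd t).div (hZd t) hZ).div_const _

/-- **Complex stability from the crux** (converse of `perturbedXYOrder_of_complexStability`). If `PerturbedXYOrder` holds with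
`(J₀, ε, a)`, then for `J ≥ J₀`, `L ≥ 2` and every kernel admissible at radius `ε/2` the perturbed partition function does not
vanish and `‖num_K/Z_K/L⁶‖ ≤ 5`: Borel–Carathéodory on the disc `‖t‖ < 2` for `t ↦ -cratio L J (t • K)`, whose real part is
`≤ -a < 1` by the crux along the ray, evaluated at `t = 1`, together with `‖cratio L J 0‖ ≤ 1`.
(Borel–Carathéodory: Mathlib `Complex.borelCaratheodory`.) [folklore] -/
theorem complexStability_of_perturbedXYOrder (h : PerturbedXYOrder) :
    ∃ J₀ ε₂ B : ℝ, 0 < ε₂ ∧ 0 < B ∧ ∀ J : ℝ, J₀ ≤ J → ∀ (L : ℕ) [NeZero L], 2 ≤ L →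
      ∀ K : Bond L → Bond L → ℂ, Admissible L ε₂ K → Zk J K ≠ 0 ∧ ‖cratio L J K‖ ≤ B := by
  rw [perturbedXYOrder_iff] at h
  obtain ⟨J₀, ε, a, hε, ha, h⟩ := h
  refine ⟨J₀, ε / 2, 5, by positivity, by norm_num, ?_⟩
  intro J hJ L _ hL K hK
  -- the crux along the ray `t • K`, `‖t‖ ≤ 2`
  have hray : ∀ t : ℂ, ‖t‖ ≤ 2 → Zk J (t • K) ≠ 0 ∧ a ≤ (cratio L J (t • K)).re :=
    fun t ht => h J hJ L hL (t • K) (equiv_admissible_ray hε.le hK ht)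
  have hZ1 : Zk J K ≠ 0 := by simpa using (hray 1 (by simp)).1
  refine ⟨hZ1, ?_⟩
  -- `f = -cratio` along the ray is holomorphic on `‖t‖ < 2` with real part `≤ -a ≤ 1`
  set f : ℂ → ℂ := fun t => -cratio L J (t • K) with hf
  have hfd : DifferentiableOn ℂ f (ball 0 2) := by
    intro t ht
    have ht' : ‖t‖ ≤ 2 := (mem_ball_zero_iff.1 ht).le
    exact (equiv_differentiableAt_cratio_ray J K (hray t ht').1).neg.differentiableWithinAt
  have hmaps : Set.MapsTo f (ball 0 2) {z : ℂ | z.re ≤ 1} := by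
    intro t ht
    have ht' : ‖t‖ ≤ 2 := (mem_ball_zero_iff.1 ht).le
    have := (hray t ht').2
    simp only [Set.mem_setOf_eq, hf, Complex.neg_re]
    linarith
  have h1 : (1 : ℂ) ∈ ball (0 : ℂ) 2 := by simp
  have hBC := Complex.borelCaratheodory (f := f) one_pos hfd hmaps two_pos h1
  -- evaluate the constants: `‖1‖ = 1`, `f 0 = -cratio L J 0`, `‖cratio L J 0‖ ≤ 1`
  have hf0 : ‖f 0‖ ≤ 1 := by
    simp only [hf, zero_smul, norm_neg]
    exact norm_cratio_zero_le_one J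
  have hf1 : f 1 = -cratio L J K := by simp [hf]
  rw [hf1, norm_neg] at hBC
  have hn1 : ‖(1 : ℂ)‖ = 1 := by simp
  rw [hn1] at hBC
  have : 2 * (1 : ℝ) * 1 / (2 - 1) + ‖f 0‖ * (2 + 1) / (2 - 1) ≤ 5 := by nlinarith [norm_nonneg (f 0)]
  exact hBC.trans this

/-- **The crux is equivalent to complex stability.** `PerturbedXYOrder` holds iff there are `J₀`, `ε₂ > 0`, `B > 0` such that for
`J ≥ J₀`, `L ≥ 2` and every kernel admissible at radius `ε₂`, `Z_K ≠ 0 ∧ ‖num_K/Z_K/L⁶‖ ≤ B` (⇐: `perturbedXYOrder_of_complexStability`,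
the line `schwarz-inheritance`; ⇒: `complexStability_of_perturbedXYOrder`). The right-hand side is verbatim the registered open stub
`stub_complexStability` of `Cruxes/PerturbedXYOrder/Lines/schwarz-inheritance.lean`. -/
theorem perturbedXYOrder_iff_complexStability :
    PerturbedXYOrder ↔
      ∃ J₀ ε₂ B : ℝ, 0 < ε₂ ∧ 0 < B ∧ ∀ J : ℝ, J₀ ≤ J → ∀ (L : ℕ) [NeZero L], 2 ≤ L →
        ∀ K : Bond L → Bond L → ℂ, Admissible L ε₂ K → Zk J K ≠ 0 ∧ ‖cratio L J K‖ ≤ B :=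
  ⟨complexStability_of_perturbedXYOrder, perturbedXYOrder_of_complexStability⟩

end Summit.HubbardSuperconductivity.HubbardSuperconductivity.Theorems.PerturbedXYOrder

end
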